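import Summits.ValiantsHypothesis.ValiantsHypothesis.Theorems.GrenetZeonDualUnipotentThreeHalvesHeavyTopThmC6Window

/-!
# `GrenetZeon.DualUnipotentThreeHalves` (stmt-ValiantsHypothesis-24318), R2 heavy-top instrument — THEOREM C(6) PORT:
# the window polynomial as a dot product over the weight-`1` coordinates (generated arithmetic)

Experiment cell «val-heavytop-census» (D-0160), engine seat val-htc-eng-1 g4 (generator `eng-1/g4/py/gen_main.py`).  Companion of ✓ `…ThmCWindow`:
for `s = 2, …, 4` the window polynomial `Σ_k C_k(c) p_k` (right side of ✓ `window_s`), with `p` the padding of a vector `v ∈ ℂ^{6−1}`, equals the dot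
product of `v` with the vector of window sums — the form consumed by the zero-slack lemma ✓ `…ThmCStructure.mem_of_dot_eq_zero` in the assembly
✓ `…HeavyTopThmC6`.

Honest framing: computational lemmas of the instrument's kernel port of Thm C(7); nothing here proves or refutes `HeavyTopLaw`/`HeavyTopSlowLaw`, 24318, S3 or
8062; `VP ≠ VNP` is NOT proved.  No definitions.  [this seat]
-/

-- single-conjunct layout: Sub = Summit, duplicated namespace component intended
set_option linter.dupNamespace false
set_option linter.unusedSimpArgs false
set_option linter.unnecessarySeqFocus false
set_option linter.unreachableTactic false
set_option linter.unusedTactic false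

namespace Summit.ValiantsHypothesis.ValiantsHypothesis.Theorems.GrenetZeon.HeavyTopThmC6WindowDot

open Matrix

set_option maxHeartbeats 4000000 in
/-- Window polynomial of ✓ `…ThmCWindow.window_2` as a dot product over `Fin (7 − 1)` (weight-`1` coordinates). -/
theorem polyDot_2 (c : Fin 6 → ℂ) (v : Fin (6 - 1) → ℂ) (p : Fin 6 → ℂ)
    (hp : ∀ a : Fin 6, p a = if ha : (a : ℕ) < 6 - 1 then v ⟨(a : ℕ), ha⟩ else 0) :
    c 0 * p 0 + c 0 * p 1 + c 1 * p 1 + c 1 * p 2 + c 2 * p 2 + c 2 * p 3 + c 3 * p 3 + c 3 * p 4 =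
      (fun k : Fin (6 - 1) => (![c 0, c 0 + c 1, c 1 + c 2, c 2 + c 3, c 3, 0] : Fin 6 → ℂ) ⟨(k : ℕ), by omega⟩) ⬝ᵥ v := by
  have e0 : p 0 = v ⟨0, by omega⟩ := by rw [hp]; rfl
  have e1 : p 1 = v ⟨1, by omega⟩ := by rw [hp]; rfl
  have e2 : p 2 = v ⟨2, by omega⟩ := by rw [hp]; rfl
  have e3 : p 3 = v ⟨3, by omega⟩ := by rw [hp]; rfl
  have e4 : p 4 = v ⟨4, by omega⟩ := by rw [hp]; rfl
  simp only [e0, e1, e2, e3, e4]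
  simp [dotProduct, Fin.sum_univ_succ]
  ring

set_option maxHeartbeats 4000000 in
/-- Window polynomial of ✓ `…ThmCWindow.window_3` as a dot product over `Fin (7 − 1)` (weight-`1` coordinates). -/
theorem polyDot_3 (c : Fin 6 → ℂ) (v : Fin (6 - 1) → ℂ) (p : Fin 6 → ℂ)
    (hp : ∀ a : Fin 6, p a = if ha : (a : ℕ) < 6 - 1 then v ⟨(a : ℕ), ha⟩ else 0) :
    c 0 * p 0 + c 0 * p 1 + c 0 * p 2 + c 1 * p 1 + c 1 * p 2 + c 1 * p 3 + c 2 * p 2 + c 2 * p 3 + c 2 * p 4 =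
      (fun k : Fin (6 - 1) => (![c 0, c 0 + c 1, c 0 + c 1 + c 2, c 1 + c 2, c 2, 0] : Fin 6 → ℂ) ⟨(k : ℕ), by omega⟩) ⬝ᵥ v := by
  have e0 : p 0 = v ⟨0, by omega⟩ := by rw [hp]; rfl
  have e1 : p 1 = v ⟨1, by omega⟩ := by rw [hp]; rfl
  have e2 : p 2 = v ⟨2, by omega⟩ := by rw [hp]; rfl
  have e3 : p 3 = v ⟨3, by omega⟩ := by rw [hp]; rfl
  have e4 : p 4 = v ⟨4, by omega⟩ := by rw [hp]; rfl
  simp only [e0, e1, e2, e3, e4]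
  simp [dotProduct, Fin.sum_univ_succ]
  ring

set_option maxHeartbeats 4000000 in
/-- Window polynomial of ✓ `…ThmCWindow.window_4` as a dot product over `Fin (7 − 1)` (weight-`1` coordinates). -/
theorem polyDot_4 (c : Fin 6 → ℂ) (v : Fin (6 - 1) → ℂ) (p : Fin 6 → ℂ)
    (hp : ∀ a : Fin 6, p a = if ha : (a : ℕ) < 6 - 1 then v ⟨(a : ℕ), ha⟩ else 0) :
    c 0 * p 0 + c 0 * p 1 + c 0 * p 2 + c 0 * p 3 + c 1 * p 1 + c 1 * p 2 + c 1 * p 3 + c 1 * p 4 =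
      (fun k : Fin (6 - 1) => (![c 0, c 0 + c 1, c 0 + c 1, c 0 + c 1, c 1, 0] : Fin 6 → ℂ) ⟨(k : ℕ), by omega⟩) ⬝ᵥ v := by
  have e0 : p 0 = v ⟨0, by omega⟩ := by rw [hp]; rfl
  have e1 : p 1 = v ⟨1, by omega⟩ := by rw [hp]; rfl
  have e2 : p 2 = v ⟨2, by omega⟩ := by rw [hp]; rfl
  have e3 : p 3 = v ⟨3, by omega⟩ := by rw [hp]; rfl
  have e4 : p 4 = v ⟨4, by omega⟩ := by rw [hp]; rfl
  simp only [e0, e1, e2, e3, e4]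
  simp [dotProduct, Fin.sum_univ_succ]
  ring

end Summit.ValiantsHypothesis.ValiantsHypothesis.Theorems.GrenetZeon.HeavyTopThmC6WindowDot
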